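import Summits.BirchSwinnertonDyer.BirchSwinnertonDyer.Theorems.SignedLowerHalvesKobayashiLowerHalfLargeImageParityStratum
import Summits.BirchSwinnertonDyer.BirchSwinnertonDyer.Theses.SignedLowerHalves
import Literature.NumberTheory.EllipticCurves.Kobayashi2003.SignedPAdicLFunctionUniqueProofs
import Literature.NumberTheory.EllipticCurves.Sprung2017.SharpFlatFunctionalEquationApZeroProofs
import HarnessLib

/-!
# Route `SignedLowerHalves`, crux 3 `KobayashiLowerHalfLargeImage` (item stmt-BirchSwinnertonDyer-19001)
# BY NAME versus its PARITY STRATUM: the crux is EQUIVALENT, modulo published named facts, to its own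
# restriction to the pairs with NO signed certificate `(μ, λ)(L_p^ε) = (0, ≤ 1)` — calibration only
# (cell `bsd-ssimc`, seat `bsd-line-slh-p1` LEAD gen 12; helper file `--supports 19001`; imports the
# route file, hence kept apart from the two `…ParityStratum*.lean` files)

HONEST FRAMING: the crux is OPEN; nothing here proves it or shrinks its hard part; BSD is not proved
by any of this. Pen rule D34-4 (3): a reduction of the crux BY NAME modulo named facts is CALIBRATION —
never an input to a registered stub, never a `closes`, never a by-name close of the item.

## What this file does

`…ParityStratum.lean` §4 (`kobayashiLowerDivisibility_of_lam_le_one`, p635988) proves Kobayashi's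
Eisenstein half at every pair carrying, for some sign `ε`, the certificate `μ(L_p^ε) = 0 ∧ λ(L_p^ε) ≤ 1`
(granted Kobayashi Thm. 1.2 `h12`, the period-unit facts `h5`/`h3`, the `p`-parity theorem `hpar`,
Sprung's signed functional equation `hFE`). Since Pollack's `L_p^ε` of the newform is UNIQUE
(`IsSignedPAdicLFunction.unique`; it also EXISTS, `pollack_exists_plusMinusPAdicLFunction_holds`, a tree
THEOREM, though only uniqueness is used), every pair is either on the stratum or off it, and at a `W`
with no newform of level `N_W` (excluded by modularity, not by Lean) `KobayashiLowerDivisibility` holds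
vacuously. Hence:

* `kobayashiLowerHalfLargeImage_of_offStratum` — **crux 3 BY NAME ⟸ its OFF-STRATUM part**: the same
  statement with the extra binder "for the newform `f₀` of level `N_E` and BOTH signs, `μ(L_p^ε) = 0`
  forces `λ(L_p^ε) ≥ 2`" (i.e. neither sign carries the certificate), granted `h12`, `h5`, `h3`,
  `hpar` (for every curve and prime), `hFE`;
* `offStratum_of_kobayashiLowerHalfLargeImage` — the converse (trivial: a restriction);
* `kobayashiLowerHalfLargeImage_iff_offStratum` — the equivalence, modulo those named facts.

READING (cycle 12 of the lead lineage, complements the rank cut p617986 and the deep-point form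
p631790): inside the X7 large-image class the crux's content is carried ENTIRELY by the pairs where
both signed `p`-adic `L`-functions have `λ ≥ 2` or `μ ≥ 1` — paired/transcendental zeros or positive
`μ` (K1G11 §2.2) —; the `p`-adic-analytic-rank-`≤ 1`, `μ = 0` pairs are settled by parity modulo
print, for EVERY complex analytic rank. This is placement, not shrinkage of the hard stub
`stub_kuriharaPartialInfty_le_tamagawa_X7` of the line of record.

References: [Kobayashi2003] Thm. 1.2, Conjecture (p. 2); [Pollack2003] Thm. 5.6, Cor. 5.11, Prop. 6.18;
[Sprung2017] Cor. 4.14; [DokchitserDokchitserAnnals2010] Thm. 1.4; [GreenbergVatsal2000] p. 4.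
Crux dir: `K1G11-SEARCH-LOG.md` §2.2 and §4; `LineReportKuriharaRigidity.md`.
-/

set_option autoImplicit false
set_option linter.dupNamespace false

noncomputable section

open scoped Classical MatrixGroups ModularForm

open CongruenceSubgroup WeierstrassCurve Literature.NumberTheory.EllipticCurves
  Literature.NumberTheory.EllipticCurves.ModularForms
  Literature.NumberTheory.EllipticCurves.Rank1Residual Literature.NumberTheory.EllipticCurves.Sprung2017
  Literature.NumberTheory.EllipticCurves.Kobayashi2003
  Literature.NumberTheory.EllipticCurves.Rank1Residual.Typed
  Summit.BirchSwinnertonDyer.Rank1Residual.X1.MuLambda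
  Summit.BirchSwinnertonDyer.Rank1Residual.Supersingular
  Summit.BirchSwinnertonDyer.BirchSwinnertonDyer.Theses.SignedLowerHalves

namespace Summit.BirchSwinnertonDyer.BirchSwinnertonDyer.Theorems.LargeImageParityStratumCrux

/-- **Crux 3 BY NAME from its OFF-STRATUM part.** Granted BY NAME Kobayashi 2003 Thm. 1.2 (`h12`),
the period-unit facts (`h5`, `h3`), the `p`-parity theorem for every `E/ℚ` and every `p` (`hpar`,
Dokchitser–Dokchitser 2010 Thm. 1.4) and Sprung's functional equation of the signed pair (`hFE`,
Cor. 4.14 at `a_p = 0`): if the crux's conclusion `∃ ε, KobayashiLowerDivisibility W p ε` holds at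
every X7 ∧ ¬CM ∧ `a_p = 0` ∧ Surj pair at odd `p` which is OFF the parity stratum — for the newform
`f₀` of level `N_E` and BOTH signs `ε`, Pollack's `L_p^ε` (any `L` with `IsSignedPAdicLFunction f₀ p ε L`,
a unique power series) has `λ ≥ 2` whenever `μ = 0` — then
`Theses.SignedLowerHalves.KobayashiLowerHalfLargeImage` holds. Proof: at a pair with a newform of
level `N_E`, either some sign carries the certificate `(μ, λ ≤ 1) ` and
`LargeImageParityStratum.kobayashiLowerDivisibility_of_lam_le_one` applies, or (uniqueness
`IsSignedPAdicLFunction.unique`) the pair is off the stratum and `hoff` applies; with no newform of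
level `N_E` the conclusion is vacuous. CALIBRATION ONLY (pen rule D34-4 (3)).
[cite: Kobayashi2003, Thm. 1.2 and Conjecture (p. 2)] [cite: DokchitserDokchitserAnnals2010, Thm. 1.4]
[cite: Sprung2017, Cor. 4.14 (a_p = 0 display)] [cite: Pollack2003, Prop. 6.9 (proof) and Prop. 6.18] -/
theorem kobayashiLowerHalfLargeImage_of_offStratum
    (h12 : Kobayashi2003.thm12_signedSelmerDual_finite_torsion)
    (h5 : realPeriodRat_eq_unit_mul_plusPeriod) (h3 : realPeriodRat_eq_unit_mul_plusPeriod_three)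
    (hpar : ∀ (W : WeierstrassCurve ℚ) [W.IsElliptic] (p : ℕ) [Fact p.Prime], p_parity W p)
    (hFE : Sprung2017.cor414_sharpFlat_functionalEquation_apZero)
    (hoff : ∀ (W : WeierstrassCurve ℚ) [W.IsElliptic] [W.IsGloballyMinimal] (p : ℕ) [Fact p.Prime],
      p ≠ 2 → ClassX7 W p → ¬ W.HasCM → W.frobeniusTrace p = 0 → Surj W p →
      (∀ [NeZero (W.conductorNorm ℤ)] (f₀ : CuspForm (Gamma0 (W.conductorNorm ℤ)) 2),
        IsNewformOf W f₀ → ∀ (ε : ℤˣ) (L : IwasawaAlgebra p),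
          IsSignedPAdicLFunction f₀ p ε L → mu L = 0 → 2 ≤ lam L) →
      ∃ ε : ℤˣ, KobayashiLowerDivisibility W p ε) :
    KobayashiLowerHalfLargeImage := by
  intro W _ _ p _ hp hX hCM hap hs
  by_cases hmod : ∃ (_ : NeZero (W.conductorNorm ℤ)) (f₀ : CuspForm (Gamma0 (W.conductorNorm ℤ)) 2),
      IsNewformOf W f₀
  · obtain ⟨inst, f₀, hf₀⟩ := hmod
    by_cases hon : ∃ ε : ℤˣ, ∀ L : IwasawaAlgebra p,
        IsSignedPAdicLFunction f₀ p ε L → mu L = 0 ∧ lam L ≤ 1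
    · -- on the stratum: part 1, §4
      obtain ⟨ε, hcert⟩ := hon
      exact ⟨ε, LargeImageParityStratum.kobayashiLowerDivisibility_of_lam_le_one W p h12 h5 h3
        (hpar W p) hFE hp hX.1.1 hap ε hf₀ hcert⟩
    · -- off the stratum: `hoff`
      refine hoff W p hp hX hCM hap hs fun f₁ hf₁ ε L hL hμ ↦ ?_
      have hff : f₁ = f₀ := hf₁.unique hf₀
      subst hff
      by_contra hlt
      refine hon ⟨ε, fun L' hL' ↦ ?_⟩
      have hLL : L' = L := hL'.unique hL
      subst hLL
      exact ⟨hμ, by omega⟩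
  · -- no newform of level `N_W`: the divisibility is vacuous
    refine ⟨1, ?_⟩
    intro κ γ _ _ _ inst f hf
    exact absurd ⟨inst, f, hf⟩ hmod

/-- **The converse (trivial): the crux implies its off-stratum part.** [cite: Kobayashi2003, Conjecture (p. 2)] -/
theorem offStratum_of_kobayashiLowerHalfLargeImage (h : KobayashiLowerHalfLargeImage) :
    ∀ (W : WeierstrassCurve ℚ) [W.IsElliptic] [W.IsGloballyMinimal] (p : ℕ) [Fact p.Prime],
      p ≠ 2 → ClassX7 W p → ¬ W.HasCM → W.frobeniusTrace p = 0 → Surj W p →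
      (∀ [NeZero (W.conductorNorm ℤ)] (f₀ : CuspForm (Gamma0 (W.conductorNorm ℤ)) 2),
        IsNewformOf W f₀ → ∀ (ε : ℤˣ) (L : IwasawaAlgebra p),
          IsSignedPAdicLFunction f₀ p ε L → mu L = 0 → 2 ≤ lam L) →
      ∃ ε : ℤˣ, KobayashiLowerDivisibility W p ε :=
  fun W _ _ p _ hp hX hCM hap hs _ ↦ h W p hp hX hCM hap hs

/-- **Crux 3 BY NAME ⟺ its off-stratum part, modulo the named facts `h12`, `h5`, `h3`, `hpar`, `hFE`.**
READING: the content of item 19001 is carried entirely by the X7 large-image pairs at which BOTH signed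
`p`-adic `L`-functions have `λ ≥ 2` or `μ ≥ 1`; the pairs with a `(μ, λ) = (0, ≤ 1)` sign are settled
by parity modulo print, at every complex analytic rank. CALIBRATION ONLY.
[cite: Kobayashi2003, Thm. 1.2 and Conjecture (p. 2)] [cite: DokchitserDokchitserAnnals2010, Thm. 1.4]
[cite: Sprung2017, Cor. 4.14 (a_p = 0 display)] -/
theorem kobayashiLowerHalfLargeImage_iff_offStratum
    (h12 : Kobayashi2003.thm12_signedSelmerDual_finite_torsion)
    (h5 : realPeriodRat_eq_unit_mul_plusPeriod) (h3 : realPeriodRat_eq_unit_mul_plusPeriod_three)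
    (hpar : ∀ (W : WeierstrassCurve ℚ) [W.IsElliptic] (p : ℕ) [Fact p.Prime], p_parity W p)
    (hFE : Sprung2017.cor414_sharpFlat_functionalEquation_apZero) :
    KobayashiLowerHalfLargeImage ↔
    ∀ (W : WeierstrassCurve ℚ) [W.IsElliptic] [W.IsGloballyMinimal] (p : ℕ) [Fact p.Prime],
      p ≠ 2 → ClassX7 W p → ¬ W.HasCM → W.frobeniusTrace p = 0 → Surj W p →
      (∀ [NeZero (W.conductorNorm ℤ)] (f₀ : CuspForm (Gamma0 (W.conductorNorm ℤ)) 2),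
        IsNewformOf W f₀ → ∀ (ε : ℤˣ) (L : IwasawaAlgebra p),
          IsSignedPAdicLFunction f₀ p ε L → mu L = 0 → 2 ≤ lam L) →
      ∃ ε : ℤˣ, KobayashiLowerDivisibility W p ε :=
  ⟨offStratum_of_kobayashiLowerHalfLargeImage,
    kobayashiLowerHalfLargeImage_of_offStratum h12 h5 h3 hpar hFE⟩

/-! ### Appendix (lead gen 12, after p639211): the functional-equation hypothesis discharged -/

/-- **Crux 3 BY NAME ⟺ its off-stratum part, modulo `h12`, `h5`, `h3` and the `p`-parity theorem
ONLY** — Sprung's functional equation is now the tree theorem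
`Sprung2017.cor414_sharpFlat_functionalEquation_apZero_holds` (p639211) and is fed here. READING: the
content of item 19001 is carried entirely by the X7 large-image pairs at which BOTH signed `p`-adic
`L`-functions have `λ ≥ 2` or `μ ≥ 1`. CALIBRATION ONLY (pen rule D34-4 (3)).
[cite: Kobayashi2003, Thm. 1.2 and Conjecture (p. 2)] [cite: DokchitserDokchitserAnnals2010, Thm. 1.4]
[cite: Sprung2017, Cor. 4.14 (a_p = 0 display)] -/
theorem kobayashiLowerHalfLargeImage_iff_offStratum'
    (h12 : Kobayashi2003.thm12_signedSelmerDual_finite_torsion)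
    (h5 : realPeriodRat_eq_unit_mul_plusPeriod) (h3 : realPeriodRat_eq_unit_mul_plusPeriod_three)
    (hpar : ∀ (W : WeierstrassCurve ℚ) [W.IsElliptic] (p : ℕ) [Fact p.Prime], p_parity W p) :
    KobayashiLowerHalfLargeImage ↔
    ∀ (W : WeierstrassCurve ℚ) [W.IsElliptic] [W.IsGloballyMinimal] (p : ℕ) [Fact p.Prime],
      p ≠ 2 → ClassX7 W p → ¬ W.HasCM → W.frobeniusTrace p = 0 → Surj W p →
      (∀ [NeZero (W.conductorNorm ℤ)] (f₀ : CuspForm (Gamma0 (W.conductorNorm ℤ)) 2),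
        IsNewformOf W f₀ → ∀ (ε : ℤˣ) (L : IwasawaAlgebra p),
          IsSignedPAdicLFunction f₀ p ε L → mu L = 0 → 2 ≤ lam L) →
      ∃ ε : ℤˣ, KobayashiLowerDivisibility W p ε :=
  kobayashiLowerHalfLargeImage_iff_offStratum h12 h5 h3 hpar cor414_sharpFlat_functionalEquation_apZero_holds

end Summit.BirchSwinnertonDyer.BirchSwinnertonDyer.Theorems.LargeImageParityStratumCrux

end
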